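import Summits.QuantumFields.BalabanUV.T4Continuum.Support.ShellMeasureWindowBall

/-!
# `T4Continuum.ShellMeasureWindowFixedCentre` — (LR)_j WITH PRINT'S FIXED CENTRE: END-II ON RAW SECTIONS (no
# tree-gauge wrapper) and the ball window (1.27) about a `V`-INDEPENDENT centre, which needs NO centre hypothesis
# (cell `pub-balaban`, sub-cell `t4`, spine estimate NE7c (node U5b); NE7c ROUND-2 crew `t4-ne7c-formalise-*`, seat
# leaf-10 (gen 2), OFFERED row (journal l.7391, FINDING F-ne7cleaf10-2), companion of rows S15
# `ShellMeasureWindowInsertion` and S20 `ShellMeasureWindowBall`; ADDITIVE — imports `ShellMeasureWindowBall`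
# (p209596) only, modifies nothing)

HONEST FRAMING.  Finite four-torus programme, rung (B)+1 only — NOT infinite volume, NOT a mass gap, NOT the Clay
problem, NOT summit progress; (B), `BetaPertHyp`, (B^μ) are not consumed.  (M1) for Bałaban's inductively defined
effective measures is NOT PRINTED (GAPS G-ne7cp1-1), asserted by nobody, NOT moved here.  NE7c ⇐ the named binders
(trigger c3); NE7c NOT PRINTED, NOT proved; spine PROVED 0/9 before and after.  STRUCTURAL BOOKKEEPING — no estimate,
0 sorry, 0 citations (the locators below say where a SHAPE is displayed; nothing printed is transcribed as a fact),
no `def` (c2).  HONEST DEPENDENCY (cell): continuum YM on T⁴ ⇐ BetaPertH ∧ nine spine estimates (0/9 proved);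
BetaPertH ⇐ (D1) ∧ (D4) ∧ CAP+tail; G-an2-4 gates asym, D1 and NE2/3/4.

THE POINT (FINDING F-ne7cleaf10-2, type-level, on OUR composition; nothing landed is false).  Row S20 derived
END-II's window binder `hFw` from a `dist1`-ball SUPPORT of the realized density about a chart centre `c V` and left
ONE hypothesis on the centre, `hc : ∀ V y, ∀ b ∈ Λ, c (fixTo T U₀ (V[Λ := y])) b = c V b`
(`ShellMeasureWindowBall.ballSupport_of_indicator_mul`).  §4 CHARACTERISES it: `hc` holds iff the centre restricted
to the chart bonds reads ONLY the bonds off `T ∪ Λ` (`hc_iff_readsOff`).  Print's centre (located SHAPE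
[Balaban1989LargeFieldI] (1.26) p. 182, `V^{(j)}_Z = M^j(U_{k,Z})`) is a FIXED configuration of the `j`-th
fluctuation integral — a function of the background, i.e. of variables NOT integrated at step `j` —, and the density
carrying the window (1.27) is ALREADY GAUGE-FIXED by print's own factors (1.5)/(1.6) (p. 182 «gauge fixing terms»).
A window about a `V`-independent centre cannot sit inside a gauge-INVARIANT `F` unless trivial
(`ShellMeasureHeadlines`, header), so print's window is read by END-II WITHOUT the tree-gauge wrapper:
`ShellMeasureRootCompositionSU2.slotAC_realized_su2_of_chartAC` (row S7b §1) is stated for ANY measurable density on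
RAW block sections `V[Λ := y]`, and the level-data assembly on top of it is verbatim E2′'s.
* §1 `slotAC_realized_su2_of_levelData_raw` — E2′
  (`ShellMeasureRootCompositionLevelZero.slotAC_realized_su2_of_levelData_cube`) with `T`, `U₀`, `hFi`, `hui`
  DELETED: any measurable `F`, `u`; window factorisation, finiteness, cube dictionary on RAW sections; SAME constant.
  An `example` RECOVERS E2′ from §1 at `(F ∘ fixTo T U₀, u ∘ fixTo T U₀)` by
  `ShellMeasureScalingLocal.slotAntiConcentration_gaugeFixed_iff`: the raw form is the general one.
* §2 `window_of_ballSupport_raw` (support ⇒ factorisation, raw sections); `ballSupport_fixedCentre` (the density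
  `1[∀ b ∈ B_w, dist1 ((c₀ b)⁻¹ U b) ≤ τ] · G` — window over ANY bond set `B_w ⊇ Λ` about a FIXED centre `c₀` — has
  the ball support on raw sections with NO hypothesis); `measurableSet_ballWindow`, `measurable_ballWindow_mul`.
* §3 `slotAC_realized_su2_of_levelData_ballWindow_fixedCentre` — (M1) for
  `(fieldMeasure P j SU2).withDensity (1[window] · G)`, `τ ≤ 2 sin(S/2)`, `G` measurable, dictionary about the
  fixed chart centre `c₀` on the cube; residual binders = SM-L1…L6 level data + dictionary + finiteness — NOTHING
  about the centre.
* §4 `hc_iff_readsOff`; `gaugeInvariant_ballWindow_of_covariant` (a gauge-COVARIANT centre makes the window set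
  gauge-invariant, `GaugeGroup.dist1_conj`) — what the tree-gauge END-II (S15/S20) is for: LOOP co-tests (centre =
  transport along a path avoiding the block; S15's plaquette co-tests are the staple case).
CONSEQUENCE FOR THE LEDGER (c3-honest).  In the fixed-centre reading of (R) — «the slot's realized law is print's
gauge-fixed level-`j` density on product Haar, centre = background = a slot PARAMETER» — the (LR)_j window leaves NO
residual hypothesis; in the invariant reading the residual is exactly «the centre reads off `T ∪ Λ`» (+ covariance
for `hFi`).  Which reading the [dict] push uses is the owner's / [dict] seat's call; both ENDs are in the tree.
WHAT THIS DOES NOT DO.  No instance of SM-L1/L3/L4/L6 at any `j ≥ 1`; (M1) per slot stays THE wall; NE7c NOT proved.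
-/

noncomputable section

open NormedSpace Set Function MeasureTheory Metric

namespace Summit.QuantumFields.BalabanUV.T4Continuum.ShellMeasureWindowFixedCentre

open scoped ENNReal
open Literature.MathematicalPhysics.QuantumFieldTheory.Balaban1983to89
open GaugeField (GaugeInvariant gaugeAct)
open T4ShellMeasure (SlotAntiConcentration)
open T4CubePoincare (cube measurableSet_cube')
open T4CubeChartGnomonic (SU2)
open T4CubeChartExp (expJac expWindowDensity expFibreChart)
open T4ShellMeasureDet (blockLaw)
open T4TreeGaugeFixing (NoClosedLoop fixTo measurable_fixTo fixTo_apply_of_mem fixTo_apply_of_not_mem)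
open T4TiltOscillation (bdev updateFinset_apply_of_mem updateFinset_apply_of_not_mem)
open T4ExpWindowSmallField (expWindowDensity_eq_one_of_dist1_bdev_le)
open ShellMeasureScalingLocal (slotAntiConcentration_gaugeFixed_iff)
open ShellMeasureScalingSU2 (chartLaw_univ_eq mem_cube_of_chartWeight_ne_zero chartWeight_le_smul)
open ShellMeasureWilsonTrace (TraceData)
open ShellMeasureWilsonMoving (MLetter mwordEval mdFro sSum lSum)
open ShellMeasureLevelAssembly (classifier weight slotAntiConcentration_of_levelData)
open ShellMeasureRootCompositionSU2 (slotAC_realized_su2_of_chartAC)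
open ShellMeasureRootCompositionLevelZero (slotAntiConcentration_congr_offNull)

variable {P : Params} {j : ℕ} [DecidableEq (PBond P j)]
variable {A : Type*} [NormedRing A] [NormedAlgebra ℂ A] [CompleteSpace A] [NormOneClass A]

/-! ## §1 END-II on raw sections: any measurable density, no tree gauge -/

/-- **END-II ON RAW SECTIONS — REALIZED (M1) ⇐ SM-L1…L6 + DICTIONARY, PER SLOT, ANY MEASURABLE DENSITY
(`G = SU(2)`).**  Word for word E2′ `ShellMeasureRootCompositionLevelZero.slotAC_realized_su2_of_levelData_cube` with
the tree-gauge data `T`, `U₀` and the invariance hypotheses `hFi`, `hui` DELETED: chart bonds `Λ` (enumeration `e`, `n`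
coordinates), `0 < S`, `3S² < π²`, centres `c V`, block weights `R V`; ANY measurable `F` with the window factorisation
`hFw` OF ITS RAW SECTIONS `y ↦ F (V[Λ := y])` and per-section finiteness `hfin`; ANY measurable `u`; LEVEL DATA per
exterior `V` (`hol`, `Gw`, `𝓔`, `W`, `Jco`, sizes, numbers) with the DICTIONARY `hRdict`/`hudict` on the chart cube read
on the RAW section `V[Λ := κ_{cV}(x)]` and the BINDERS `hJW`/`hJ` (SM-L5/L6), `hAN` (SM-L1), `hGW` (SM-L3), `hE` (SM-L4),
`hSM` (SM-L2).  CONCLUSION (E2′'s): `SlotAntiConcentration ((fieldMeasure P j SU2).withDensity F) u θ ρ (2(n + β Σ_p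
L̄_p(d̄_p + 4s̄_p) + B_𝓔)/(1−δ))` — the END for a density ALREADY gauge-fixed (print's (1.5)/(1.6) inside `F`).
CONDITIONAL on every binder; nothing PRINTED is asserted. [folklore] -/
theorem slotAC_realized_su2_of_levelData_raw (Λ : Finset (PBond P j)) {n : ℕ} (e : ↥Λ × Fin 3 ≃ Fin n)
    {S : ℝ} (hS : 0 < S) (hSπ : 3 * S ^ 2 < Real.pi ^ 2) (c : GaugeField P j SU2 → GaugeField P j SU2)
    {R : GaugeField P j SU2 → (↥Λ → SU2) → ℝ≥0∞} (hR : ∀ V, Measurable (R V))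
    {F : GaugeField P j SU2 → ℝ≥0∞} (hF : Measurable F)
    (hFw : ∀ V y, F (updateFinset V Λ y) =
      ENNReal.ofReal (expWindowDensity Λ (c V) S (updateFinset (c V) Λ y)) * R V y)
    (hfin : ∀ V, ((blockLaw Λ).withDensity fun y => F (updateFinset V Λ y)) univ ≠ ∞)
    {u : GaugeField P j SU2 → ℝ} (hu : Measurable u)
    -- level data per exterior section
    (Ttr : TraceData A) (hN : 0 < Ttr.N) {ι κ : Type*} {Pu : Finset ι} (hPu : Pu.Nonempty)
    (hol : GaugeField P j SU2 → ι → (Fin n → ℝ) → A) (hcont : ∀ V, ∀ p ∈ Pu, Continuous (hol V p))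
    (Pw : Finset κ) (Gw : GaugeField P j SU2 → κ → (Fin n → ℝ) → A) (𝓔 : GaugeField P j SU2 → (Fin n → ℝ) → ℝ)
    (W : GaugeField P j SU2 → Set (Fin n → ℝ)) (Jco : GaugeField P j SU2 → (Fin n → ℝ) → ℝ≥0∞)
    {θ δ ρ β Rad H B𝓔 : ℝ} {sw lw dw : κ → ℝ}
    -- DICTIONARY (on the chart cube only, RAW sections)
    (hRdict : ∀ V, ∀ x ∈ cube n S,
      R V (expFibreChart Λ (c V) e x) = Jco V x * weight Ttr β Pw (Gw V) (𝓔 V) x)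
    (hudict : ∀ V, ∀ x ∈ cube n S,
      u (updateFinset V Λ (expFibreChart Λ (c V) e x)) = classifier hPu (hol V) x)
    -- SM-L5/L6: kept co-tests supported in the window, centre-monotone
    (hJW : ∀ V x, Jco V x ≠ 0 → x ∈ W V)
    (hJ : ∀ V x, ∀ a : ℝ, 0 ≤ a → Jco V x ≤ Jco V (Real.exp (-a) • x))
    -- SM-L1 (AN-bound)
    (hRad : 1 < Rad)
    (hAN : ∀ V, ∀ x ∈ W V, ∀ p ∈ Pu, ∃ f : ℂ → A, DifferentiableOn ℂ f (ball 0 Rad) ∧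
      (∀ w ∈ ball (0 : ℂ) Rad, ‖f w‖ ≤ H) ∧ f 0 = 0 ∧ ∀ c' : ℝ, 0 ≤ c' → c' ≤ 1 → f (c' : ℂ) = hol V p (c' • x) - 1)
    -- SM-L3 graded sectioned words
    (hGW : ∀ V, ∀ x ∈ W V, ∀ p ∈ Pw, ∃ gw : List (MLetter A × ℝ × ℝ), (∀ y ∈ gw, y.1.Good Ttr.τ y.2.1 y.2.2) ∧
      sSum gw ≤ sw p ∧ lSum gw ≤ lw p ∧ mdFro (gw.map Prod.fst) ≤ dw p ∧
      ∀ c' : ℝ, 0 ≤ c' → c' ≤ 1 → mwordEval c' (gw.map Prod.fst) = Gw V p (c' • x))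
    (hsw1 : ∀ p ∈ Pw, sw p ≤ 1) (hsw0 : ∀ p ∈ Pw, 0 ≤ sw p) (hlw0 : ∀ p ∈ Pw, 0 ≤ lw p)
    (hdw0 : ∀ p ∈ Pw, 0 ≤ dw p)
    -- SM-L4 non-Wilson ray bound
    (hE : ∀ V, ∀ x ∈ W V, ∀ c' : ℝ, 1 / 2 ≤ c' → c' ≤ 1 → 𝓔 V (c' • x) ≤ 𝓔 V x + (1 - c') * B𝓔) (hB𝓔 : 0 ≤ B𝓔)
    -- numbers + SM-L2 (SM)
    (hθ : 0 < θ) (hδ0 : 0 ≤ δ) (hδ1 : δ < 1) (hρ0 : 0 ≤ ρ) (hρ : ρ ≤ (1 - δ) / 2) (hβ : 0 ≤ β)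
    (hSM : 36 * H * 1 ^ 2 / (Rad - 1) ^ 2 ≤ δ * θ) :
    SlotAntiConcentration ((fieldMeasure P j SU2).withDensity F) u θ ρ
      (2 * ((n : ℝ) + (β * ∑ p ∈ Pw, lw p * (dw p + 4 * sw p) + B𝓔)) / (1 - δ)) := by
  refine slotAC_realized_su2_of_chartAC Λ e hS hSπ c hR hF hFw hu fun V => ?_
  -- the chart law of the raw section
  have hsecF : (fun y => F (updateFinset V Λ y)) =
      fun y => ENNReal.ofReal (expWindowDensity Λ (c V) S (updateFinset (c V) Λ y)) * R V y := funext (hFw V)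
  -- the density rewritten through the dictionary ON THE CUBE; off the cube both sides vanish
  have hdens : (fun x : Fin n → ℝ => (cube n S).indicator (fun x => ENNReal.ofReal (Real.exp (-expJac Λ e x))) x *
        R V (expFibreChart Λ (c V) e x)) =
      fun x => ((cube n S).indicator (fun x => ENNReal.ofReal (Real.exp (-expJac Λ e x))) x * Jco V x) *
        weight Ttr β Pw (Gw V) (𝓔 V) x := by
    funext x
    by_cases hx : x ∈ cube n S
    · rw [hRdict V x hx, mul_assoc]
    · simp only [indicator_of_notMem hx, zero_mul]
  rw [hdens]
  -- finiteness of the sub-threshold mass of the chart law (from the section's finite mass)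
  have hfin' : ((volume : Measure (Fin n → ℝ)).withDensity fun x =>
      ((cube n S).indicator (fun x => ENNReal.ofReal (Real.exp (-expJac Λ e x))) x * Jco V x) *
        weight Ttr β Pw (Gw V) (𝓔 V) x) {x | classifier hPu (hol V) x < θ} ≠ ∞ := by
    refine ne_top_of_le_ne_top ?_ (measure_mono (subset_univ _))
    rw [← hdens, chartLaw_univ_eq Λ (c V) e hS hSπ (hR V), ← hsecF]
    exact hfin V
  -- the one-depth assembly on the chart, window ∩ cube as the window, chart weight × co-tests as the factor
  have h := slotAntiConcentration_of_levelData (volume : Measure (Fin n → ℝ)) Ttr hN hPu (hol V) (hcont V) Pw (Gw V)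
    (𝓔 V) (W := W V ∩ cube n S)
    (J := fun x => (cube n S).indicator (fun x => ENNReal.ofReal (Real.exp (-expJac Λ e x))) x * Jco V x)
    (fun x hx => ⟨hJW V x (right_ne_zero_of_mul hx), mem_cube_of_chartWeight_ne_zero (left_ne_zero_of_mul hx)⟩)
    (fun x a ha => mul_le_mul' (chartWeight_le_smul e hSπ ha x) (hJ V x a ha)) hRad
    (fun x hx p hp => hAN V x hx.1 p hp) (fun x hx p hp => hGW V x hx.1 p hp) hsw1 hsw0 hlw0 hdw0
    (fun x hx c' h1 h2 => hE V x hx.1 c' h1 h2) hB𝓔 hθ hδ0 hδ1 hρ0 hρ hβ hSM hfin'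
  simp only [Module.finrank_fintype_fun_eq_card, Fintype.card_fin] at h
  -- the tested variable is read through the dictionary ON THE CUBE; off the cube the chart law vanishes
  exact slotAntiConcentration_congr_offNull volume (measurableSet_cube' n S)
    (fun x hx => by simp only [indicator_of_notMem hx, zero_mul]) (hudict V) h

/- **CERTIFICATE (an `example`, not a declaration: its statement IS E2′, already landed): THE RAW FORM IS THE GENERAL
ONE.**  The tree-gauge END-II `ShellMeasureRootCompositionLevelZero.slotAC_realized_su2_of_levelData_cube` (loop-free
`T`, values `U₀`, gauge-invariant `F`, `u`, every hypothesis asked of the tree-gauged sections) is §1 applied to the pair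
`(F ∘ fixTo T U₀, u ∘ fixTo T U₀)`, transported back by `ShellMeasureScalingLocal.slotAntiConcentration_gaugeFixed_iff`. -/
example {T : Finset (PBond P j)} (hT : NoClosedLoop T)
    (U₀ : GaugeField P j SU2) (Λ : Finset (PBond P j)) {n : ℕ} (e : ↥Λ × Fin 3 ≃ Fin n)
    {S : ℝ} (hS : 0 < S) (hSπ : 3 * S ^ 2 < Real.pi ^ 2) (c : GaugeField P j SU2 → GaugeField P j SU2)
    {R : GaugeField P j SU2 → (↥Λ → SU2) → ℝ≥0∞} (hR : ∀ V, Measurable (R V))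
    {F : GaugeField P j SU2 → ℝ≥0∞} (hF : Measurable F) (hFi : GaugeInvariant F)
    (hFw : ∀ V y, F (fixTo T U₀ (updateFinset V Λ y)) =
      ENNReal.ofReal (expWindowDensity Λ (c V) S (updateFinset (c V) Λ y)) * R V y)
    (hfin : ∀ V, ((blockLaw Λ).withDensity fun y => F (fixTo T U₀ (updateFinset V Λ y))) univ ≠ ∞)
    {u : GaugeField P j SU2 → ℝ} (hu : Measurable u) (hui : GaugeInvariant u)
    (Ttr : TraceData A) (hN : 0 < Ttr.N) {ι κ : Type*} {Pu : Finset ι} (hPu : Pu.Nonempty)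
    (hol : GaugeField P j SU2 → ι → (Fin n → ℝ) → A) (hcont : ∀ V, ∀ p ∈ Pu, Continuous (hol V p))
    (Pw : Finset κ) (Gw : GaugeField P j SU2 → κ → (Fin n → ℝ) → A) (𝓔 : GaugeField P j SU2 → (Fin n → ℝ) → ℝ)
    (W : GaugeField P j SU2 → Set (Fin n → ℝ)) (Jco : GaugeField P j SU2 → (Fin n → ℝ) → ℝ≥0∞)
    {θ δ ρ β Rad H B𝓔 : ℝ} {sw lw dw : κ → ℝ}
    (hRdict : ∀ V, ∀ x ∈ cube n S,
      R V (expFibreChart Λ (c V) e x) = Jco V x * weight Ttr β Pw (Gw V) (𝓔 V) x)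
    (hudict : ∀ V, ∀ x ∈ cube n S,
      u (fixTo T U₀ (updateFinset V Λ (expFibreChart Λ (c V) e x))) = classifier hPu (hol V) x)
    (hJW : ∀ V x, Jco V x ≠ 0 → x ∈ W V)
    (hJ : ∀ V x, ∀ a : ℝ, 0 ≤ a → Jco V x ≤ Jco V (Real.exp (-a) • x))
    (hRad : 1 < Rad)
    (hAN : ∀ V, ∀ x ∈ W V, ∀ p ∈ Pu, ∃ f : ℂ → A, DifferentiableOn ℂ f (ball 0 Rad) ∧
      (∀ w ∈ ball (0 : ℂ) Rad, ‖f w‖ ≤ H) ∧ f 0 = 0 ∧ ∀ c' : ℝ, 0 ≤ c' → c' ≤ 1 → f (c' : ℂ) = hol V p (c' • x) - 1)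
    (hGW : ∀ V, ∀ x ∈ W V, ∀ p ∈ Pw, ∃ gw : List (MLetter A × ℝ × ℝ), (∀ y ∈ gw, y.1.Good Ttr.τ y.2.1 y.2.2) ∧
      sSum gw ≤ sw p ∧ lSum gw ≤ lw p ∧ mdFro (gw.map Prod.fst) ≤ dw p ∧
      ∀ c' : ℝ, 0 ≤ c' → c' ≤ 1 → mwordEval c' (gw.map Prod.fst) = Gw V p (c' • x))
    (hsw1 : ∀ p ∈ Pw, sw p ≤ 1) (hsw0 : ∀ p ∈ Pw, 0 ≤ sw p) (hlw0 : ∀ p ∈ Pw, 0 ≤ lw p)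
    (hdw0 : ∀ p ∈ Pw, 0 ≤ dw p)
    (hE : ∀ V, ∀ x ∈ W V, ∀ c' : ℝ, 1 / 2 ≤ c' → c' ≤ 1 → 𝓔 V (c' • x) ≤ 𝓔 V x + (1 - c') * B𝓔) (hB𝓔 : 0 ≤ B𝓔)
    (hθ : 0 < θ) (hδ0 : 0 ≤ δ) (hδ1 : δ < 1) (hρ0 : 0 ≤ ρ) (hρ : ρ ≤ (1 - δ) / 2) (hβ : 0 ≤ β)
    (hSM : 36 * H * 1 ^ 2 / (Rad - 1) ^ 2 ≤ δ * θ) :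
    SlotAntiConcentration ((fieldMeasure P j SU2).withDensity F) u θ ρ
      (2 * ((n : ℝ) + (β * ∑ p ∈ Pw, lw p * (dw p + 4 * sw p) + B𝓔)) / (1 - δ)) :=
  (slotAntiConcentration_gaugeFixed_iff hT U₀ hF hFi hu hui).1
    (slotAC_realized_su2_of_levelData_raw Λ e hS hSπ c hR (hF.comp (measurable_fixTo T U₀)) hFw hfin
      (hu.comp (measurable_fixTo T U₀)) Ttr hN hPu hol hcont Pw Gw 𝓔 W Jco hRdict hudict hJW hJ hRad hAN hGW
      hsw1 hsw0 hlw0 hdw0 hE hB𝓔 hθ hδ0 hδ1 hρ0 hρ hβ hSM)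

/-! ## §2 The ball window about a fixed centre, on raw sections -/

/-- **THE WINDOW FACTORISATION FROM A BALL SUPPORT, RAW SECTIONS.**  Chart bonds `Λ`, centres `c V`, `0 ≤ S`: if the
raw sections of `F` vanish unless every chart bond sits in the chord ball `dist1 ((c V b)⁻¹ · y_b) ≤ 2 sin(S/2)` (the
SHAPE of print's (1.27)), then `F (V[Λ := y]) = χ_{Λ,cV,S}((cV)[Λ := y]) · F (V[Λ := y])` — §1's `hFw` with
`R V y := F (V[Λ := y])` (`T4ExpWindowSmallField.expWindowDensity_eq_one_of_dist1_bdev_le`). [folklore] -/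
theorem window_of_ballSupport_raw (Λ : Finset (PBond P j)) (c : GaugeField P j SU2 → GaugeField P j SU2) {S : ℝ}
    (hS : 0 ≤ S) {F : GaugeField P j SU2 → ℝ≥0∞}
    (hFsupp : ∀ V y, F (updateFinset V Λ y) ≠ 0 →
      ∀ b (hb : b ∈ Λ), dist1 ((c V b)⁻¹ * y ⟨b, hb⟩) ≤ 2 * Real.sin (S / 2))
    (V : GaugeField P j SU2) (y : ↥Λ → SU2) :
    F (updateFinset V Λ y) =
      ENNReal.ofReal (expWindowDensity Λ (c V) S (updateFinset (c V) Λ y)) * F (updateFinset V Λ y) := by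
  by_cases h0 : F (updateFinset V Λ y) = 0
  · rw [h0, mul_zero]
  · have hwin : expWindowDensity Λ (c V) S (updateFinset (c V) Λ y) = 1 :=
      expWindowDensity_eq_one_of_dist1_bdev_le hS fun b hb => by
        rw [bdev, updateFinset_apply_of_mem _ _ hb]
        exact hFsupp V y h0 b hb
    rw [hwin, ENNReal.ofReal_one, one_mul]

/-- **PRINT'S WINDOW ABOUT A FIXED CENTRE HAS THE BALL SUPPORT — NO HYPOTHESIS.**  For the concrete density
`F = 1[∀ b ∈ B_w, dist1 ((c₀ b)⁻¹ · U b) ≤ τ] · G` (the window (1.27) over a bond set `B_w`, centre a FIXED configuration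
`c₀` — print's (1.26) `V^{(j)}_Z`, a slot parameter —, `G` arbitrary) and chart bonds `Λ ⊆ B_w`, the raw sections vanish
unless every chart bond is in the `τ`-ball about `c₀`.  Compare `ShellMeasureWindowBall.ballSupport_of_indicator_mul`,
whose centre FUNCTION needed `hc`. [folklore] -/
theorem ballSupport_fixedCentre {Bw Λ : Finset (PBond P j)} (hΛ : Λ ⊆ Bw) (c₀ : GaugeField P j SU2) (τ : ℝ)
    (G : GaugeField P j SU2 → ℝ≥0∞) (V : GaugeField P j SU2) (y : ↥Λ → SU2)
    (hne : {U : GaugeField P j SU2 | ∀ b ∈ Bw, dist1 ((c₀ b)⁻¹ * U b) ≤ τ}.indicator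
        (1 : GaugeField P j SU2 → ℝ≥0∞) (updateFinset V Λ y) * G (updateFinset V Λ y) ≠ 0) :
    ∀ b (hb : b ∈ Λ), dist1 ((c₀ b)⁻¹ * y ⟨b, hb⟩) ≤ τ := by
  intro b hb
  have hmem : updateFinset V Λ y ∈ {U : GaugeField P j SU2 | ∀ b ∈ Bw, dist1 ((c₀ b)⁻¹ * U b) ≤ τ} := by
    by_contra h
    exact hne (mul_eq_zero_of_left (indicator_of_notMem h _) _)
  have h := hmem b (hΛ hb)
  rwa [updateFinset_apply_of_mem _ _ hb] at h

omit [DecidableEq (PBond P j)] in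
/-- The window set `{U | ∀ b ∈ B_w, dist1 ((c₀ b)⁻¹ · U b) ≤ τ}` is measurable (`RegularGaugeGroup.measurable_dist1`,
`Missing.measurable_eval`). [folklore] -/
theorem measurableSet_ballWindow (Bw : Finset (PBond P j)) (c₀ : GaugeField P j SU2) (τ : ℝ) :
    MeasurableSet {U : GaugeField P j SU2 | ∀ b ∈ Bw, dist1 ((c₀ b)⁻¹ * U b) ≤ τ} := by
  have h : {U : GaugeField P j SU2 | ∀ b ∈ Bw, dist1 ((c₀ b)⁻¹ * U b) ≤ τ} =
      ⋂ b ∈ Bw, {U : GaugeField P j SU2 | dist1 ((c₀ b)⁻¹ * U b) ≤ τ} := by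
    ext U
    simp only [mem_setOf_eq, mem_iInter]
  rw [h]
  refine Finset.measurableSet_biInter Bw fun b _ => ?_
  exact measurableSet_le
    (RegularGaugeGroup.measurable_dist1.comp (measurable_const.mul (Missing.measurable_eval b))) measurable_const

omit [DecidableEq (PBond P j)] in
/-- … so the concrete density `1[window] · G` is measurable for measurable `G` (§1's `hF`). [folklore] -/
theorem measurable_ballWindow_mul (Bw : Finset (PBond P j)) (c₀ : GaugeField P j SU2) (τ : ℝ)
    {G : GaugeField P j SU2 → ℝ≥0∞} (hG : Measurable G) :
    Measurable fun U => {U : GaugeField P j SU2 | ∀ b ∈ Bw, dist1 ((c₀ b)⁻¹ * U b) ≤ τ}.indicator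
      (1 : GaugeField P j SU2 → ℝ≥0∞) U * G U :=
  (measurable_one.indicator (measurableSet_ballWindow Bw c₀ τ)).mul hG

/-! ## §3 END-II for print's window about a fixed centre: no centre hypothesis left -/

/-- **END-II, FIXED-CENTRE BALL WINDOW — REALIZED (M1) ⇐ SM-L1…L4 + (SM) + DICTIONARY, PER SLOT, ANY LEVEL;
NOTHING IS ASKED OF THE CENTRE (`G = SU(2)`).**  Data: a bond set `B_w` carrying print's window (1.27) of radius
`τ ≤ 2 sin(S/2)` about a FIXED configuration `c₀` (print's (1.26) — a slot parameter), chart bonds `Λ ⊆ B_w`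
(enumeration `e`, `0 < S`, `3S² < π²`), a measurable factor `G` (the rest of the slot's gauge-fixed density, incl.
print's gauge-fixing factors (1.5)/(1.6) and the window over `B_w ∖ Λ`); realized density
`F = 1[∀ b ∈ B_w, dist1 ((c₀ b)⁻¹ · U b) ≤ τ] · G`; measurable `u`; per-section finiteness; §1's level data with
SM-L1 `hAN`, SM-L3 `hGW` + sizes, SM-L4 `hE`, SM-L5/L6 `hJW`/`hJ`, numbers, SM-L2 `hSM`; the dictionary read on the
density's own RAW section about the fixed chart centre `c₀`, on the cube (`hFdict`, `hudict`; the window indicator over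
`Λ` is one of the kept co-tests inside `Jco`, `ShellMeasureWindowBall.ballInd_le_smul` its `hJ`).  CONCLUSION (E2′'s):
`SlotAntiConcentration ((fieldMeasure P j SU2).withDensity F) u θ ρ (2(n + βΣ_p L̄_p(d̄_p + 4s̄_p) + B_𝓔)/(1−δ))` —
NO `hc`, NO `GaugeInvariant` (§1 + §2).  CONDITIONAL on every displayed binder; nothing PRINTED is asserted. [folklore] -/
theorem slotAC_realized_su2_of_levelData_ballWindow_fixedCentre {Bw Λ : Finset (PBond P j)} (hΛ : Λ ⊆ Bw)
    (c₀ : GaugeField P j SU2) {τ : ℝ} {n : ℕ} (e : ↥Λ × Fin 3 ≃ Fin n)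
    {S : ℝ} (hS : 0 < S) (hSπ : 3 * S ^ 2 < Real.pi ^ 2) (hτ : τ ≤ 2 * Real.sin (S / 2))
    {G : GaugeField P j SU2 → ℝ≥0∞} (hG : Measurable G)
    (hfin : ∀ V, ((blockLaw Λ).withDensity fun y =>
      {U : GaugeField P j SU2 | ∀ b ∈ Bw, dist1 ((c₀ b)⁻¹ * U b) ≤ τ}.indicator (1 : GaugeField P j SU2 → ℝ≥0∞)
        (updateFinset V Λ y) * G (updateFinset V Λ y)) univ ≠ ∞)
    {u : GaugeField P j SU2 → ℝ} (hu : Measurable u)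
    -- level data per exterior section (§1's, verbatim)
    (Ttr : TraceData A) (hN : 0 < Ttr.N) {ι κ : Type*} {Pu : Finset ι} (hPu : Pu.Nonempty)
    (hol : GaugeField P j SU2 → ι → (Fin n → ℝ) → A) (hcont : ∀ V, ∀ p ∈ Pu, Continuous (hol V p))
    (Pw : Finset κ) (Gw : GaugeField P j SU2 → κ → (Fin n → ℝ) → A) (𝓔 : GaugeField P j SU2 → (Fin n → ℝ) → ℝ)
    (W : GaugeField P j SU2 → Set (Fin n → ℝ)) (Jco : GaugeField P j SU2 → (Fin n → ℝ) → ℝ≥0∞)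
    {θ δ ρ β Rad H B𝓔 : ℝ} {sw lw dw : κ → ℝ}
    -- DICTIONARY (the density's own RAW sections about the fixed centre, on the chart cube only)
    (hFdict : ∀ V, ∀ x ∈ cube n S,
      {U : GaugeField P j SU2 | ∀ b ∈ Bw, dist1 ((c₀ b)⁻¹ * U b) ≤ τ}.indicator (1 : GaugeField P j SU2 → ℝ≥0∞)
          (updateFinset V Λ (expFibreChart Λ c₀ e x)) * G (updateFinset V Λ (expFibreChart Λ c₀ e x)) =
        Jco V x * weight Ttr β Pw (Gw V) (𝓔 V) x)
    (hudict : ∀ V, ∀ x ∈ cube n S,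
      u (updateFinset V Λ (expFibreChart Λ c₀ e x)) = classifier hPu (hol V) x)
    -- SM-L5/L6: kept co-tests supported in the window, centre-monotone
    (hJW : ∀ V x, Jco V x ≠ 0 → x ∈ W V)
    (hJ : ∀ V x, ∀ a : ℝ, 0 ≤ a → Jco V x ≤ Jco V (Real.exp (-a) • x))
    -- SM-L1 (AN-bound)
    (hRad : 1 < Rad)
    (hAN : ∀ V, ∀ x ∈ W V, ∀ p ∈ Pu, ∃ f : ℂ → A, DifferentiableOn ℂ f (ball 0 Rad) ∧
      (∀ w ∈ ball (0 : ℂ) Rad, ‖f w‖ ≤ H) ∧ f 0 = 0 ∧ ∀ c' : ℝ, 0 ≤ c' → c' ≤ 1 → f (c' : ℂ) = hol V p (c' • x) - 1)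
    -- SM-L3 graded sectioned words
    (hGW : ∀ V, ∀ x ∈ W V, ∀ p ∈ Pw, ∃ gw : List (MLetter A × ℝ × ℝ), (∀ y ∈ gw, y.1.Good Ttr.τ y.2.1 y.2.2) ∧
      sSum gw ≤ sw p ∧ lSum gw ≤ lw p ∧ mdFro (gw.map Prod.fst) ≤ dw p ∧
      ∀ c' : ℝ, 0 ≤ c' → c' ≤ 1 → mwordEval c' (gw.map Prod.fst) = Gw V p (c' • x))
    (hsw1 : ∀ p ∈ Pw, sw p ≤ 1) (hsw0 : ∀ p ∈ Pw, 0 ≤ sw p) (hlw0 : ∀ p ∈ Pw, 0 ≤ lw p)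
    (hdw0 : ∀ p ∈ Pw, 0 ≤ dw p)
    -- SM-L4 non-Wilson ray bound
    (hE : ∀ V, ∀ x ∈ W V, ∀ c' : ℝ, 1 / 2 ≤ c' → c' ≤ 1 → 𝓔 V (c' • x) ≤ 𝓔 V x + (1 - c') * B𝓔) (hB𝓔 : 0 ≤ B𝓔)
    -- numbers + SM-L2 (SM)
    (hθ : 0 < θ) (hδ0 : 0 ≤ δ) (hδ1 : δ < 1) (hρ0 : 0 ≤ ρ) (hρ : ρ ≤ (1 - δ) / 2) (hβ : 0 ≤ β)
    (hSM : 36 * H * 1 ^ 2 / (Rad - 1) ^ 2 ≤ δ * θ) :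
    SlotAntiConcentration ((fieldMeasure P j SU2).withDensity fun U =>
        {U : GaugeField P j SU2 | ∀ b ∈ Bw, dist1 ((c₀ b)⁻¹ * U b) ≤ τ}.indicator (1 : GaugeField P j SU2 → ℝ≥0∞) U *
          G U) u θ ρ
      (2 * ((n : ℝ) + (β * ∑ p ∈ Pw, lw p * (dw p + 4 * sw p) + B𝓔)) / (1 - δ)) :=
  slotAC_realized_su2_of_levelData_raw Λ e hS hSπ (fun _ => c₀)
    (R := fun V y => {U : GaugeField P j SU2 | ∀ b ∈ Bw, dist1 ((c₀ b)⁻¹ * U b) ≤ τ}.indicator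
      (1 : GaugeField P j SU2 → ℝ≥0∞) (updateFinset V Λ y) * G (updateFinset V Λ y))
    (fun _ => (measurable_ballWindow_mul Bw c₀ τ hG).comp measurable_updateFinset)
    (measurable_ballWindow_mul Bw c₀ τ hG)
    (window_of_ballSupport_raw Λ (fun _ => c₀) hS.le
      (F := fun U => {U : GaugeField P j SU2 | ∀ b ∈ Bw, dist1 ((c₀ b)⁻¹ * U b) ≤ τ}.indicator
        (1 : GaugeField P j SU2 → ℝ≥0∞) U * G U)
      fun V y hne b hb => (ballSupport_fixedCentre hΛ c₀ τ G V y hne b hb).trans hτ)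
    hfin hu Ttr hN hPu hol hcont Pw Gw 𝓔 W Jco hFdict hudict hJW hJ hRad hAN hGW hsw1 hsw0 hlw0 hdw0 hE hB𝓔 hθ hδ0
    hδ1 hρ0 hρ hβ hSM

/-! ## §4 The invariant route made explicit: S20's `hc` characterised; covariant centres -/

/-- **ROW S20's CENTRE HYPOTHESIS CHARACTERISED.**  For any bond sets `T`, `Λ`, values `U₀`, centre function `c`:
`hc` of `ShellMeasureWindowBall.ballSupport_of_indicator_mul` — `c (fixTo T U₀ (V[Λ := y])) b = c V b` on `Λ` — holds
IFF the centre restricted to `Λ` READS ONLY THE BONDS OFF `T ∪ Λ` (fields agreeing off `T` and off `Λ` have the same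
centre on `Λ`; direction `.2` is the form suppliers meet).  A fixed configuration (print's (1.26)) satisfies it
trivially — but a non-trivial window about it cannot sit inside a gauge-invariant `F` (§3 is its END); the other
solutions are centres built from the exterior off the tree, e.g. transports along paths avoiding `T ∪ Λ` (loop
co-tests). [folklore] -/
theorem hc_iff_readsOff (T Λ : Finset (PBond P j)) (U₀ : GaugeField P j SU2)
    (c : GaugeField P j SU2 → GaugeField P j SU2) :
    (∀ (V : GaugeField P j SU2) (y : ↥Λ → SU2), ∀ b ∈ Λ, c (fixTo T U₀ (updateFinset V Λ y)) b = c V b) ↔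
      ∀ V V' : GaugeField P j SU2, (∀ b', b' ∉ T → b' ∉ Λ → V b' = V' b') → ∀ b ∈ Λ, c V b = c V' b := by
  constructor
  · intro hc V V' hVV' b hb
    have key : fixTo T U₀ (updateFinset V Λ fun b : ↥Λ => V b) =
        fixTo T U₀ (updateFinset V' Λ fun b : ↥Λ => V b) := by
      funext b'
      by_cases hT : b' ∈ T
      · rw [fixTo_apply_of_mem hT, fixTo_apply_of_mem hT]
      · rw [fixTo_apply_of_not_mem hT, fixTo_apply_of_not_mem hT]
        by_cases hΛ' : b' ∈ Λ
        · rw [updateFinset_apply_of_mem _ _ hΛ', updateFinset_apply_of_mem _ _ hΛ']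
        · rw [updateFinset_apply_of_not_mem _ _ hΛ', updateFinset_apply_of_not_mem _ _ hΛ', hVV' b' hT hΛ']
    rw [← hc V (fun b : ↥Λ => V b) b hb, key, hc V' _ b hb]
  · intro h V y b hb
    refine h _ _ (fun b' hT hΛ' => ?_) b hb
    rw [fixTo_apply_of_not_mem hT, updateFinset_apply_of_not_mem _ _ hΛ']

omit [DecidableEq (PBond P j)] in
/-- **A GAUGE-COVARIANT CENTRE MAKES THE WINDOW SET GAUGE-INVARIANT.**  If `c (U^u) b = u(b₋) · c U b · u(b₊)⁻¹` on
`B_w` (the transformation law of a transport between the endpoints of `b`), then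
`(c (U^u) b)⁻¹ · U^u b = u(b₊) · ((c U b)⁻¹ · U b) · u(b₊)⁻¹`, so by `GaugeGroup.dist1_conj` the window indicator
`1[∀ b ∈ B_w, dist1 ((c U b)⁻¹ · U b) ≤ τ]` is a gauge-invariant function — the form the tree-gauge END-II (S15/S20) needs
for its `hFi` (times any invariant `G`).  A FIXED centre is not covariant. [folklore] -/
theorem gaugeInvariant_ballWindow_of_covariant (Bw : Finset (PBond P j))
    (c : GaugeField P j SU2 → GaugeField P j SU2)
    (hcov : ∀ (u : GaugeTransf P j SU2) (U : GaugeField P j SU2), ∀ b ∈ Bw,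
      c (gaugeAct u U) b = u b.src * c U b * (u b.tgt)⁻¹) (τ : ℝ) :
    GaugeInvariant ({U : GaugeField P j SU2 | ∀ b ∈ Bw, dist1 ((c U b)⁻¹ * U b) ≤ τ}.indicator
      (1 : GaugeField P j SU2 → ℝ≥0∞)) := by
  intro u U
  have hiff : gaugeAct u U ∈ {U : GaugeField P j SU2 | ∀ b ∈ Bw, dist1 ((c U b)⁻¹ * U b) ≤ τ} ↔
      U ∈ {U : GaugeField P j SU2 | ∀ b ∈ Bw, dist1 ((c U b)⁻¹ * U b) ≤ τ} := by
    simp only [mem_setOf_eq]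
    refine forall₂_congr fun b hb => ?_
    have hconj : (c (gaugeAct u U) b)⁻¹ * gaugeAct u U b = u b.tgt * ((c U b)⁻¹ * U b) * (u b.tgt)⁻¹ := by
      rw [hcov u U b hb, show gaugeAct u U b = u b.src * U b * (u b.tgt)⁻¹ from rfl]
      group
    rw [hconj, GaugeGroup.dist1_conj]
  by_cases hU : U ∈ {U : GaugeField P j SU2 | ∀ b ∈ Bw, dist1 ((c U b)⁻¹ * U b) ≤ τ}
  · rw [indicator_of_mem hU, indicator_of_mem (hiff.2 hU)]
    rfl
  · rw [indicator_of_notMem hU, indicator_of_notMem (mt hiff.1 hU)]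

end Summit.QuantumFields.BalabanUV.T4Continuum.ShellMeasureWindowFixedCentre

end
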